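import Literature.NumberTheory.LFunctions.SiegelZeroClassNumberAllConductors
import HarnessLib

/-!
# I.1 for EVERY real primitive character, part 2: the EVEN column — `h_K · R_K`, and `h_K` alone, of the
# exceptional REAL quadratic field under a real zero (all conductors `q ≡ 1 (4)`, `4m`, `8m`), kernel,
# explicit, fact-free

Topic `Literature/NumberTheory/LFunctions` (namespace `Literature.NumberTheory.LFunctions`, sub-namespace
`SiegelZeroClassNumber`; continuing `SiegelZeroClassNumberAllConductors.lean`, which has the bridge
`dedekindZeta_eq_of_even` / `lOne_re_eq_of_even` (`L(1,χ) = 2 h_K R_K/√q`) / `exists_field_of_even` and the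
odd column). Everything in this file is PROVED (theorems only; no definition, no named fact, debt 0). Cell
`parity-realchar` (SIEGEL INSTRUMENT, conditionals column, topic I.1 «class numbers»): closes the
`-- TODO(general form): even d_K > 0` of `RealQuadraticSiegelZeroClassNumberRegulator.lean` (which treats
odd `d_K = q` through `jacobiChar q`) — the statements below are character-side and hold for every EVEN
primitive quadratic `χ` mod `q` and every quadratic field `K` with `d_K = q` (it exists:
`SiegelZeroClassNumber.exists_field_of_even`; `w_K = 2`, `r₁ = 2`, `r₂ = 0`):

* `classNumber_mul_regulator_ge_of_even` **`0.405 √q (1 − β) ≤ h_K R_K`** (`q ≥ 10⁴`, window `1/(10 log q)`);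
  `classNumber_mul_regulator_le_of_even` **`h_K R_K ≤ ½ √q log²q (1 − β)`** (`q ≥ 232`, window `1/40`);
  `…_le_of_even_quarter` `≤ (55/2) √q log²q (1 − β)` (window `1/4`); `…_two_sided_of_even`;
  `classNumber_mul_regulator_bounds_of_isSiegelZero_even` **`0.405 √q/(η log q) ≤ h_K R_K ≤ (55/2) √q log q/η`**,
  `…_of_forty_le` `≤ √q log q/(2η)` — Siegel's theorem in its real-quadratic currency, explicit;
* NEW for the even column — the class number ALONE, through the kernel regulator floor `R_K ≥ ½ log(q/4)`
  (`RealZeroRepulsion.half_log_le_regulator`: `ε_q = (G + B√q)/2 ≥ (1 + √q)/2`): `classNumber_le_of_even`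
  **`h_K ≤ √q log²q (1 − β)/log(q/4)`**, `classNumber_le_of_even_explicit` **`h_K ≤ 1.2 √q log q (1 − β)`**
  (`q ≥ 4096`), `classNumber_le_of_isSiegelZero_even` **`h_K ≤ 66 √q/η`** (`η ≥ 10`),
  `classNumber_le_of_isSiegelZero_even_of_forty_le` **`h_K ≤ 1.2 √q/η`** (`η ≥ 40`) — one logarithm BETTER
  than the odd column (`h_K ≤ (1/π) √q log²q (1−β)`), because the regulator of the exceptional real quadratic
  field is itself `≥ ½ log(q/4)`;
* packaged with the existence of the field: `exists_field_bounds_of_isSiegelZero_even`.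

No LOWER bound for `h_K` alone is possible here (that would need an upper bound for `R_K`, i.e. for the
fundamental unit, which `d_K` does not control polynomially); the lower bound is for `h_K R_K`.

LABEL (cell rule): instrument (kernel) / conditionals I.1, even column, all conductors. WHAT THIS IS NOT: no
claim that a real zero exists; nothing here bears on parity (H5).

## References

* [MontgomeryVaughan2007] §9.3 Theorem 9.13; §11.2 Theorem 11.4 (11.10) (both halves, kernel versions).
* [NeukirchANT1999] Ch. VII §5 (5.11) (class number formula, real quadratic case).
* [JacobsonWilliams2008] §3.3 (`ε = (G + B√D)/2`, the regulator floor).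
* [TaoTeravainen2021] Definition 1.4 (`IsSiegelZero`).
-/

noncomputable section

open Complex
open Literature.Barriers.Parity
open Literature.NumberTheory.QuadraticFields Literature.NumberTheory.QuadraticFields.Quadratic
open _root_.NumberField _root_.NumberField.Units _root_.NumberField.InfinitePlace Module

namespace Literature.NumberTheory.LFunctions

namespace SiegelZeroClassNumber

/-! ### Numerics -/

/-- `log q ≥ 9` for `q ≥ 10⁴`. [folklore] -/
private theorem nine_le_log' {q : ℕ} (hq : 10 ^ 4 ≤ q) : (9 : ℝ) ≤ Real.log q := by
  have hq' : (10 : ℝ) ^ 4 ≤ q := by exact_mod_cast hq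
  rw [Real.le_log_iff_exp_le (by linarith)]
  have h1 : Real.exp 9 = Real.exp 1 ^ 9 := by rw [← Real.exp_nat_mul]; norm_num
  rw [h1]
  calc Real.exp 1 ^ 9 ≤ 2.7182818286 ^ 9 :=
        pow_le_pow_left₀ (Real.exp_pos 1).le Real.exp_one_lt_d9.le 9
    _ ≤ (10 : ℝ) ^ 4 := by norm_num
    _ ≤ q := hq'

/-- `log q > 0` for `q ≥ 2`. [folklore] -/
private theorem log_pos_of_two_le {q : ℕ} (hq : 2 ≤ q) : 0 < Real.log q :=
  Real.log_pos (by exact_mod_cast (show 1 < q by omega))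

/-- `log(q/4) ≥ (5/6) log q` for `q ≥ 4096 = 4⁶`. [folklore] -/
private theorem log_div_four_ge {q : ℕ} (hq : 4096 ≤ q) : 5 / 6 * Real.log q ≤ Real.log ((q : ℝ) / 4) := by
  have hq0 : (0 : ℝ) < q := by exact_mod_cast (show 0 < q by omega)
  have hq' : (4096 : ℝ) ≤ q := by exact_mod_cast hq
  rw [Real.log_div hq0.ne' (by norm_num)]
  have h4 : Real.log ((4 : ℝ) ^ 6) ≤ Real.log q := Real.log_le_log (by norm_num) (by norm_num; linarith)
  rw [Real.log_pow] at h4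
  push_cast at h4
  linarith

/-- `log(q/4) > 0` for `q ≥ 5`. [folklore] -/
private theorem log_div_four_pos {q : ℕ} (hq : 5 ≤ q) : 0 < Real.log ((q : ℝ) / 4) := by
  have hq' : (5 : ℝ) ≤ q := by exact_mod_cast hq
  exact Real.log_pos (by rw [lt_div_iff₀ (by norm_num)]; linarith)

/-- A primitive character to a modulus `q ≥ 2` is non-trivial. [folklore] -/
private theorem ne_one_of_isPrimitive' {q : ℕ} [NeZero q] {χ : DirichletCharacter ℂ q} (hq : 2 ≤ q)
    (hprim : χ.IsPrimitive) : χ ≠ 1 := by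
  rintro rfl
  rw [DirichletCharacter.isPrimitive_def, DirichletCharacter.conductor_one] at hprim
  omega

variable {q : ℕ} [NeZero q] {χ : DirichletCharacter ℂ q}
variable {K : Type*} [Field K] [NumberField K]

/-! ### EVEN characters: `h_K · R_K` of the real quadratic field `d_K = q`, and `h_K` alone -/

/-- **`h_K R_K ≥ 0.405 √q (1 − β)` (kernel, fact-free; all even conductors).** For an even primitive quadratic
`χ` mod `q ≥ 10⁴`, a real zero `β ≥ 1 − 1/(10 log q)` of `L(s,χ)`, and any quadratic `K` with `d_K = q`:
`L(1,χ) = 2 h_K R_K/√q ≥ 0.81 (1 − β)`. [cite: MontgomeryVaughan2007, §11.2 (11.10)]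
[cite: NeukirchANT1999, Ch. VII §5 (5.11)] -/
theorem classNumber_mul_regulator_ge_of_even (h2 : finrank ℚ K = 2)
    (hdK : NumberField.discr K = (q : ℤ)) (hq : 10 ^ 4 ≤ q) (hprim : χ.IsPrimitive)
    (hquad : χ.IsQuadratic) (heven : χ.Even) {β : ℝ} (hβ : 1 - 1 / (10 * Real.log q) ≤ β)
    (hz : χ.LFunction β = 0) :
    0.405 * Real.sqrt q * (1 - β) ≤ (classNumber K : ℝ) * regulator K := by
  have hlow := RealZeroRepulsion.lOne_ge_of_realZero_tenth χ hq hprim hquad hz hβ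
  rw [lOne_re_eq_of_even h2 hdK (by omega) hprim hquad heven] at hlow
  have hsqrt : (0 : ℝ) < Real.sqrt q := Real.sqrt_pos.mpr (by exact_mod_cast (show 0 < q by omega))
  rw [le_div_iff₀ hsqrt] at hlow
  linarith

/-- **`h_K R_K ≤ ½ √q log²q (1 − β)` (kernel; window `1/(40 log q)`, `q ≥ 232`; all even conductors).**
[cite: MontgomeryVaughan2007, §11.2 (11.10)] [cite: NeukirchANT1999, Ch. VII §5 (5.11)] -/
theorem classNumber_mul_regulator_le_of_even (h2 : finrank ℚ K = 2)
    (hdK : NumberField.discr K = (q : ℤ)) (hq : 232 ≤ q) (hprim : χ.IsPrimitive)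
    (hquad : χ.IsQuadratic) (heven : χ.Even) {β : ℝ} (hβ : 1 - 1 / (40 * Real.log q) ≤ β)
    (hz : χ.LFunction β = 0) :
    (classNumber K : ℝ) * regulator K ≤ 1 / 2 * Real.sqrt q * Real.log q ^ 2 * (1 - β) := by
  have hup := DirichletAbel.norm_LFunction_one_le_log_sq_of_realZero hq hprim hβ hz
  rw [norm_lOne_eq_of_even h2 hdK (by omega) hprim hquad heven] at hup
  have hsqrt : (0 : ℝ) < Real.sqrt q := Real.sqrt_pos.mpr (by exact_mod_cast (show 0 < q by omega))
  rw [div_le_iff₀ hsqrt] at hup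
  linarith

/-- **`h_K R_K ≤ (55/2) √q log²q (1 − β)` on the window `1/(4 log q)` (`q ≥ 8`; all even conductors).**
[cite: MontgomeryVaughan2007, §11.2 (11.10)] [cite: NeukirchANT1999, Ch. VII §5 (5.11)] -/
theorem classNumber_mul_regulator_le_of_even_quarter (h2 : finrank ℚ K = 2)
    (hdK : NumberField.discr K = (q : ℤ)) (hq : 8 ≤ q) (hprim : χ.IsPrimitive)
    (hquad : χ.IsQuadratic) (heven : χ.Even) {β : ℝ} (hβ : 1 - 1 / (4 * Real.log q) ≤ β)
    (hz : χ.LFunction β = 0) :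
    (classNumber K : ℝ) * regulator K ≤ 55 / 2 * Real.sqrt q * Real.log q ^ 2 * (1 - β) := by
  have hup := RealZeroRepulsion.norm_LFunction_one_le_mul_log_sq hq χ
    (ne_one_of_isPrimitive' (by omega) hprim) hβ hz
  rw [norm_lOne_eq_of_even h2 hdK (by omega) hprim hquad heven] at hup
  have hsqrt : (0 : ℝ) < Real.sqrt q := Real.sqrt_pos.mpr (by exact_mod_cast (show 0 < q by omega))
  rw [div_le_iff₀ hsqrt] at hup
  linarith

/-- **Two-sided, kernel (even conductors):** `q ≥ 10⁴`, real zero `β ≥ 1 − 1/(40 log q)`: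
`0.405 √q (1−β) ≤ h_K R_K ≤ ½ √q log²q (1−β)` for every quadratic `K` with `d_K = q`.
[cite: MontgomeryVaughan2007, §11.2 (11.10)] [cite: NeukirchANT1999, Ch. VII §5 (5.11)] -/
theorem classNumber_mul_regulator_two_sided_of_even (h2 : finrank ℚ K = 2)
    (hdK : NumberField.discr K = (q : ℤ)) (hq : 10 ^ 4 ≤ q) (hprim : χ.IsPrimitive)
    (hquad : χ.IsQuadratic) (heven : χ.Even) {β : ℝ} (hβ : 1 - 1 / (40 * Real.log q) ≤ β)
    (hz : χ.LFunction β = 0) :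
    0.405 * Real.sqrt q * (1 - β) ≤ (classNumber K : ℝ) * regulator K ∧
      (classNumber K : ℝ) * regulator K ≤ 1 / 2 * Real.sqrt q * Real.log q ^ 2 * (1 - β) := by
  have hL9 := nine_le_log' hq
  have hβ10 : 1 - 1 / (10 * Real.log q) ≤ β := by
    have : 1 / (40 * Real.log q) ≤ 1 / (10 * Real.log q) :=
      one_div_le_one_div_of_le (by positivity) (by linarith)
    linarith
  exact ⟨classNumber_mul_regulator_ge_of_even h2 hdK hq hprim hquad heven hβ10 hz,
    classNumber_mul_regulator_le_of_even h2 hdK (le_trans (by norm_num) hq) hprim hquad heven hβ hz⟩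

/-- **`h_K R_K` under a Siegel zero of quality `η` (kernel, all even conductors):** if an even `χ` mod
`q ≥ 10⁴` carries a Siegel zero of quality `η`, then for every quadratic `K` with `d_K = q`:
**`0.405 √q/(η log q) ≤ h_K R_K ≤ (55/2) √q log q/η`** — Siegel's theorem in its real-quadratic currency,
explicit. [cite: TaoTeravainen2021, Definition 1.4] [cite: MontgomeryVaughan2007, §11.2 (11.10)]
[cite: NeukirchANT1999, Ch. VII §5 (5.11)] -/
theorem classNumber_mul_regulator_bounds_of_isSiegelZero_even (h2 : finrank ℚ K = 2)
    (hdK : NumberField.discr K = (q : ℤ)) (hq : 10 ^ 4 ≤ q) {η : ℝ} (hS : IsSiegelZero χ η)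
    (heven : χ.Even) :
    0.405 * Real.sqrt q / (η * Real.log q) ≤ (classNumber K : ℝ) * regulator K ∧
      (classNumber K : ℝ) * regulator K ≤ 55 / 2 * Real.sqrt q * Real.log q / η := by
  obtain ⟨hprim, hquad, h10, hzero⟩ := hS
  have hL9 := nine_le_log' hq
  have hL0 : 0 < Real.log q := by linarith
  have hη0 : 0 < η := by linarith
  set β : ℝ := 1 - 1 / (η * Real.log q) with hβdef
  have hκ : 1 - β = 1 / (η * Real.log q) := by rw [hβdef]; ring
  have hβ10 : 1 - 1 / (10 * Real.log q) ≤ β := by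
    have : 1 / (η * Real.log q) ≤ 1 / (10 * Real.log q) :=
      one_div_le_one_div_of_le (by positivity) (mul_le_mul_of_nonneg_right h10 hL0.le)
    rw [hβdef]; linarith
  have hβ4 : 1 - 1 / (4 * Real.log q) ≤ β := by
    have : 1 / (10 * Real.log q) ≤ 1 / (4 * Real.log q) :=
      one_div_le_one_div_of_le (by positivity) (by linarith)
    linarith
  have hlow := classNumber_mul_regulator_ge_of_even h2 hdK hq hprim hquad heven hβ10 hzero
  have hup := classNumber_mul_regulator_le_of_even_quarter h2 hdK (le_trans (by norm_num) hq) hprim hquad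
    heven hβ4 hzero
  rw [hκ] at hlow hup
  constructor
  · calc 0.405 * Real.sqrt q / (η * Real.log q)
        = 0.405 * Real.sqrt q * (1 / (η * Real.log q)) := by ring
      _ ≤ (classNumber K : ℝ) * regulator K := hlow
  · calc (classNumber K : ℝ) * regulator K
        ≤ 55 / 2 * Real.sqrt q * Real.log q ^ 2 * (1 / (η * Real.log q)) := hup
      _ = 55 / 2 * Real.sqrt q * Real.log q / η := by field_simp

/-- **Quality `η ≥ 40`: `h_K R_K ≤ √q log q/(2η)`** (even conductors). [cite: TaoTeravainen2021, Definition 1.4]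
[cite: MontgomeryVaughan2007, §11.2 (11.10)] -/
theorem classNumber_mul_regulator_le_of_isSiegelZero_even_of_forty_le (h2 : finrank ℚ K = 2)
    (hdK : NumberField.discr K = (q : ℤ)) (hq : 10 ^ 4 ≤ q) {η : ℝ} (hS : IsSiegelZero χ η)
    (heven : χ.Even) (h40 : 40 ≤ η) :
    (classNumber K : ℝ) * regulator K ≤ 1 / 2 * Real.sqrt q * Real.log q / η := by
  obtain ⟨hprim, hquad, -, hzero⟩ := hS
  have hL9 := nine_le_log' hq
  have hL0 : 0 < Real.log q := by linarith
  have hη0 : 0 < η := by linarith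
  set β : ℝ := 1 - 1 / (η * Real.log q) with hβdef
  have hκ : 1 - β = 1 / (η * Real.log q) := by rw [hβdef]; ring
  have hβ40 : 1 - 1 / (40 * Real.log q) ≤ β := by
    have : 1 / (η * Real.log q) ≤ 1 / (40 * Real.log q) :=
      one_div_le_one_div_of_le (by positivity) (mul_le_mul_of_nonneg_right h40 hL0.le)
    rw [hβdef]; linarith
  have hup := classNumber_mul_regulator_le_of_even h2 hdK (le_trans (by norm_num) hq) hprim hquad heven
    hβ40 hzero
  rw [hκ] at hup
  calc (classNumber K : ℝ) * regulator K
      ≤ 1 / 2 * Real.sqrt q * Real.log q ^ 2 * (1 / (η * Real.log q)) := hup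
    _ = 1 / 2 * Real.sqrt q * Real.log q / η := by field_simp

/-! ### EVEN characters: the class number ALONE, through the regulator floor `R_K ≥ ½ log(q/4)` -/

/-- **`h_K ≤ √q log²q (1 − β)/log(q/4)` (kernel; all even conductors).** For an even primitive quadratic `χ`
mod `q ≥ 232`, a real zero `β ≥ 1 − 1/(40 log q)`, and any quadratic `K` with `d_K = q`: the bound
`h_K R_K ≤ ½ √q log²q (1 − β)` and the regulator floor `R_K ≥ ½ log(d_K/4)` (the fundamental unit is
`(G + B√q)/2 ≥ (1 + √q)/2`; tree `RealZeroRepulsion.half_log_le_regulator`).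
[cite: MontgomeryVaughan2007, §11.2 (11.10)] [cite: JacobsonWilliams2008, §3.3 (ε = (G + B√D)/2)]
[cite: NeukirchANT1999, Ch. VII §5 (5.11)] -/
theorem classNumber_le_of_even (h2 : finrank ℚ K = 2) (hdK : NumberField.discr K = (q : ℤ))
    (hq : 232 ≤ q) (hprim : χ.IsPrimitive) (hquad : χ.IsQuadratic) (heven : χ.Even) {β : ℝ}
    (hβ : 1 - 1 / (40 * Real.log q) ≤ β) (hz : χ.LFunction β = 0) :
    (classNumber K : ℝ) ≤ Real.sqrt q * Real.log q ^ 2 * (1 - β) / Real.log ((q : ℝ) / 4) := by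
  have hup := classNumber_mul_regulator_le_of_even h2 hdK hq hprim hquad heven hβ hz
  have hd : 0 < NumberField.discr K := by rw [hdK]; exact_mod_cast (show 0 < q by omega)
  have hR := RealZeroRepulsion.half_log_le_regulator h2 hd
  have htoNat : ((NumberField.discr K).toNat : ℝ) = q := by rw [hdK]; simp
  rw [htoNat] at hR
  have hlog := log_div_four_pos (q := q) (by omega)
  have hh : (0 : ℝ) ≤ classNumber K := Nat.cast_nonneg _
  rw [le_div_iff₀ hlog]
  -- `h · log(q/4) ≤ 2 h R ≤ √q log²q (1−β)`
  have h1 : (classNumber K : ℝ) * Real.log ((q : ℝ) / 4) ≤ 2 * ((classNumber K : ℝ) * regulator K) := by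
    have := mul_le_mul_of_nonneg_left hR hh
    linarith
  linarith

/-- **`h_K ≤ 1.2 √q log q (1 − β)` (kernel, `q ≥ 4096`; all even conductors)** — the previous bound with
`log(q/4) ≥ (5/6) log q`: one logarithm better than the odd column (`h_K ≤ (1/π) √q log²q (1−β)`), the
regulator absorbing a `log q`. [cite: MontgomeryVaughan2007, §11.2 (11.10)]
[cite: JacobsonWilliams2008, §3.3 (ε = (G + B√D)/2)] -/
theorem classNumber_le_of_even_explicit (h2 : finrank ℚ K = 2) (hdK : NumberField.discr K = (q : ℤ))
    (hq : 4096 ≤ q) (hprim : χ.IsPrimitive) (hquad : χ.IsQuadratic) (heven : χ.Even) {β : ℝ}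
    (hβ : 1 - 1 / (40 * Real.log q) ≤ β) (hz : χ.LFunction β = 0) :
    (classNumber K : ℝ) ≤ 1.2 * Real.sqrt q * Real.log q * (1 - β) := by
  have h := classNumber_le_of_even h2 hdK (le_trans (by norm_num) hq) hprim hquad heven hβ hz
  have hlog := log_div_four_pos (q := q) (by omega)
  have hlog56 := log_div_four_ge hq
  have hL0 : 0 < Real.log q := log_pos_of_two_le (by omega)
  have hβ1 : β < 1 := RealZeroRepulsion.realZero_lt_one χ (ne_one_of_isPrimitive' (by omega) hprim) hz
  have hsqrt : 0 ≤ Real.sqrt q := Real.sqrt_nonneg _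
  have hnum : 0 ≤ Real.sqrt q * Real.log q * (1 - β) := by
    have : 0 ≤ 1 - β := by linarith
    positivity
  rw [le_div_iff₀ hlog] at h
  -- `h · (5/6) log q ≤ h · log(q/4) ≤ √q log²q (1−β)`
  have hh : (0 : ℝ) ≤ classNumber K := Nat.cast_nonneg _
  have h1 : (classNumber K : ℝ) * (5 / 6 * Real.log q) ≤ Real.sqrt q * Real.log q ^ 2 * (1 - β) :=
    le_trans (mul_le_mul_of_nonneg_left hlog56 hh) h
  -- divide by `(5/6) log q > 0`
  have h2' : (classNumber K : ℝ) ≤ Real.sqrt q * Real.log q ^ 2 * (1 - β) / (5 / 6 * Real.log q) := by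
    rw [le_div_iff₀ (by positivity)]; exact h1
  calc (classNumber K : ℝ) ≤ Real.sqrt q * Real.log q ^ 2 * (1 - β) / (5 / 6 * Real.log q) := h2'
    _ = 1.2 * Real.sqrt q * Real.log q * (1 - β) := by field_simp; ring

/-- **The class number of the exceptional REAL quadratic field under a Siegel zero of quality `η ≥ 10`:
`h_K ≤ 66 √q/η`** (kernel, `q ≥ 10⁴`, all even conductors; window `1/(4 log q)`, constant `(55/2)·(12/5)`).
[cite: TaoTeravainen2021, Definition 1.4] [cite: MontgomeryVaughan2007, §11.2 (11.10)]
[cite: JacobsonWilliams2008, §3.3 (ε = (G + B√D)/2)] -/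
theorem classNumber_le_of_isSiegelZero_even (h2 : finrank ℚ K = 2) (hdK : NumberField.discr K = (q : ℤ))
    (hq : 10 ^ 4 ≤ q) {η : ℝ} (hS : IsSiegelZero χ η) (heven : χ.Even) :
    (classNumber K : ℝ) ≤ 66 * Real.sqrt q / η := by
  have hb := (classNumber_mul_regulator_bounds_of_isSiegelZero_even h2 hdK hq hS heven).2
  have h10 := hS.2.2.1
  have hη0 : 0 < η := by linarith
  have hd : 0 < NumberField.discr K := by rw [hdK]; exact_mod_cast (show 0 < q by omega)
  have hR := RealZeroRepulsion.half_log_le_regulator h2 hd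
  have htoNat : ((NumberField.discr K).toNat : ℝ) = q := by rw [hdK]; simp
  rw [htoNat] at hR
  have hlog56 := log_div_four_ge (q := q) (le_trans (by norm_num) hq)
  have hL9 := nine_le_log' hq
  -- `R_K ≥ (5/12) log q`
  have hR' : 5 / 12 * Real.log q ≤ regulator K := by linarith
  have hh : (0 : ℝ) ≤ classNumber K := Nat.cast_nonneg _
  have h1 : (classNumber K : ℝ) * (5 / 12 * Real.log q) ≤ 55 / 2 * Real.sqrt q * Real.log q / η :=
    le_trans (mul_le_mul_of_nonneg_left hR' hh) hb
  rw [le_div_iff₀ hη0]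
  rw [le_div_iff₀ hη0] at h1
  have hsqrt : 0 ≤ Real.sqrt q := Real.sqrt_nonneg _
  have hLnn : (0 : ℝ) ≤ Real.log q := by linarith
  nlinarith [mul_nonneg hh (le_of_lt hη0), mul_nonneg hsqrt hLnn]

/-- **Quality `η ≥ 40`: `h_K ≤ 1.2 √q/η`** for the exceptional real quadratic field (kernel, `q ≥ 10⁴`, all
even conductors). [cite: TaoTeravainen2021, Definition 1.4] [cite: MontgomeryVaughan2007, §11.2 (11.10)]
[cite: JacobsonWilliams2008, §3.3 (ε = (G + B√D)/2)] -/
theorem classNumber_le_of_isSiegelZero_even_of_forty_le (h2 : finrank ℚ K = 2)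
    (hdK : NumberField.discr K = (q : ℤ)) (hq : 10 ^ 4 ≤ q) {η : ℝ} (hS : IsSiegelZero χ η)
    (heven : χ.Even) (h40 : 40 ≤ η) :
    (classNumber K : ℝ) ≤ 1.2 * Real.sqrt q / η := by
  obtain ⟨hprim, hquad, -, hzero⟩ := hS
  have hL9 := nine_le_log' hq
  have hL0 : 0 < Real.log q := by linarith
  have hη0 : 0 < η := by linarith
  set β : ℝ := 1 - 1 / (η * Real.log q) with hβdef
  have hκ : 1 - β = 1 / (η * Real.log q) := by rw [hβdef]; ring
  have hβ40 : 1 - 1 / (40 * Real.log q) ≤ β := by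
    have : 1 / (η * Real.log q) ≤ 1 / (40 * Real.log q) :=
      one_div_le_one_div_of_le (by positivity) (mul_le_mul_of_nonneg_right h40 hL0.le)
    rw [hβdef]; linarith
  have hup := classNumber_le_of_even_explicit h2 hdK (le_trans (by norm_num) hq) hprim hquad heven hβ40 hzero
  rw [hκ] at hup
  calc (classNumber K : ℝ) ≤ 1.2 * Real.sqrt q * Real.log q * (1 / (η * Real.log q)) := hup
    _ = 1.2 * Real.sqrt q / η := by field_simp

/-- **Packaged form (even):** under a Siegel zero of quality `η` at an even `χ` mod `q ≥ 10⁴`, the exceptional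
real quadratic field EXISTS, `h_K R_K` is pinned and `h_K` is small:
`∃ K, [K:ℚ] = 2, d_K = q, 0.405 √q/(η log q) ≤ h_K R_K ≤ (55/2) √q log q/η, h_K ≤ 66 √q/η`.
[cite: TaoTeravainen2021, Definition 1.4] [cite: MontgomeryVaughan2007, §9.3 Theorem 9.13; §11.2 (11.10)] -/
theorem exists_field_bounds_of_isSiegelZero_even (hq : 10 ^ 4 ≤ q) {η : ℝ} (hS : IsSiegelZero χ η)
    (heven : χ.Even) :
    ∃ (K : Type) (_ : Field K) (_ : NumberField K), finrank ℚ K = 2 ∧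
      NumberField.discr K = (q : ℤ) ∧
      0.405 * Real.sqrt q / (η * Real.log q) ≤ (classNumber K : ℝ) * regulator K ∧
      (classNumber K : ℝ) * regulator K ≤ 55 / 2 * Real.sqrt q * Real.log q / η ∧
      (classNumber K : ℝ) ≤ 66 * Real.sqrt q / η := by
  obtain ⟨K, hF, hNF, h2, hdK⟩ := exists_field_of_even (by omega) hS.1 hS.2.1 heven
  obtain ⟨hlo, hhi⟩ := classNumber_mul_regulator_bounds_of_isSiegelZero_even h2 hdK hq hS heven
  exact ⟨K, hF, hNF, h2, hdK, hlo, hhi, classNumber_le_of_isSiegelZero_even h2 hdK hq hS heven⟩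

end SiegelZeroClassNumber

end Literature.NumberTheory.LFunctions

end
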